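import Summits.Schanuel.Schanuel.Theorems.RootDecomp1KHyper77

/-!
# RootDecomp1KHyper — lens 6, generation 18 «BILOG STAIRCASE CELL — THE MEMBER PACKAGE Q1/Q2» (BilogStair.lean EDITION 9 c88597c7…5692, 6929 l; §T appended, §A–§S byte-identical to edition 8 = tree `RootDecomp1KHyper53`–`75`) — continuation (RootDecomp1KHyper78): §T.4 the tuple-generic PLANTED-STAIRCASE CRITERION and `¬ HasHLPairInSpan z_B` mod `PiEllMeasure` / mod Baker (Q1)

(lens-6 g18 `BilogStair.lean` EDITION 9, sha256 c88597c719d23fd42e88a1c5ede12e838e786bf53aa652e8b381b4b663795692, 6929 l, own farm rc 0 · 0 warn · 0 sorry · axioms std; §A–§S = editions 2–8 (ported as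
`RootDecomp1KHyper53`–`75`), ONE import line (`RootDecomp1KHyper51`, the tree's `HasMeasuredRatAnchor`) ADDED and §T appended in edition 9 (NOTE/CLAIM L1849, critic ACK L1855, NODE/EDITION9 L1872 / REQUEST L1873 / RESULT L1874, writer re-check L1877, critic VERDICT L1879 (CLEARED; the reserved K-R20 THIRD⁗ CELL credit AWARDED to lens-6; port GO));
port by census-1 gen 17 as `RootDecomp1KHyper76`–`79`: 76 = §T.1 `PiEllMeasure`, the Baker 1975 Thm 3.1 copy `Baker1975Thm31` (character-identical to
`Literature.NumberTheory.Transcendental.baker1975_thm_3_1`, consumed BY NAME; TODO: replace by the import + `baker1975_thm_3_1_holds` when the Baker chain builds on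
the farm), `piEllMeasure_of_baker` + §T.2 the good level of the tower; 77 = §T.3 the forms of `z_B`, `SmallFormsArePlantedAt`, LEMMA P `smallFormsArePlanted_zB_of`;
78 = §T.4 the tuple-generic PLANTED-STAIRCASE CRITERION `not_hasHLPairInSpan_of_planted` + `not_hasHLPairInSpan_zB_of` / `not_hasHLPairInSpan_zB_of_baker` (Q1);
79 = §T.5 the `HasMeasuredRatAnchor` placement of `z_B` (Q2: `exists_measured_pair_of_hasMeasuredRatAnchor_zB`, `logLattice_mem_of_hasMeasuredRatAnchor_zB`,
`hasMeasuredRatAnchor_zB_of_mvWeakMeasure`/`'`) + §T.6 `placement_zB''`. PORT EDITS: generic one-liners `mul_le_pow_of_two_le` / `sq_le_two_pow_pred` / `two_pow_le_exp_nat` /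
`half_le_ell` / `tau_lt_one` / `mvaeval_mem_adjoin` private (+ per-part private copies of earlier private helpers); statements and proofs verbatim. `--supports stmt-Schanuel-33363`;
no census credit carried; rung 0 — nothing here proves HyperLiouvilleSchanuel in general.)
-/

open Complex Polynomial IntermediateField Filter
open scoped BigOperators

namespace Summit.Schanuel.Schanuel.Theorems.RootDecomp1KHyper

namespace HyperCell

namespace LatCell

namespace Bilog

variable {n : ℕ}
open Summit.Schanuel.Schanuel.Theorems.RootDecomp1KRelLiouvilleCell (mvPolyMeasure_one_of_polyMeasure ycoeff
  mvaeval_cons_eq_sum mvlen_ycoeff_le natDegree_finSuccEquiv_le_totalDegree norm_mvaeval_le_mvlen_mul_pow)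

open Summit.Schanuel.Schanuel.Theorems.RootDecomp1KGeneric (norm_mvAeval_sub_le norm_cexp_sub_cexp_le lenMv
  lenMv_nonneg)

section MemberPkg

open Summit.Schanuel.Schanuel.Theorems.RootDecomp1KGeneric (HasHLPairInSpan)

/-- `2^A ≤ exp A`. -/
private theorem two_pow_le_exp_nat (A : ℕ) : (2 : ℝ) ^ A ≤ Real.exp A := by
  calc (2 : ℝ) ^ A ≤ Real.exp 1 ^ A :=
        pow_le_pow_left₀ (by norm_num) (by have := Real.add_one_le_exp (1 : ℝ); linarith) A
    _ = Real.exp A := by rw [← Real.exp_nat_mul, mul_one]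

/-! ### §T.4  The planted-staircase criterion (tuple-generic) and `¬ HasHLPairInSpan z_B` -/

set_option maxHeartbeats 800000 in
/-- **PLANTED-STAIRCASE CRITERION** (the tree's `RootDecomp1KHyper26.not_hasHLPairInSpan_yQ_of`, made generic in the
tuple): if the planted forms of `z` obey `‖h_K · z‖ ≥ 2^{−a_{K+1}}` and every small form of `z` is planted, then
`span_ℤ(z)` contains no hyper-Liouville pair.  (An HL pair `(v, ρv)` with coefficient vectors `u, u'` produces, from
every good approximation `p/q` of `ρ`, a non-zero small form `p u − q u'` in the plane `⊥ (u × u')`; it is planted,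
`= t·h_K` with `K` large, and the PLANE LEMMA `eq_zero_of_Edef_eq_zero` forces `u × u' = 0`, i.e. `ρ ∈ ℚ`.) -/
theorem not_hasHLPairInSpan_of_planted {z : Fin 3 → ℂ}
    (hlow : ∀ K, 1 / (2 : ℝ) ^ hexp (K + 1) ≤ ‖∑ i, (hKvec K i : ℂ) * z i‖)
    (hP : SmallFormsArePlantedAt z) : ¬ HasHLPairInSpan z := by
  rintro ⟨v, ρ, hv0, hρ, hv, hρv⟩
  obtain ⟨u, hu⟩ := (Submodule.mem_span_range_iff_exists_fun ℤ).mp hv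
  obtain ⟨u', hu'⟩ := (Submodule.mem_span_range_iff_exists_fun ℤ).mp hρv
  simp only [zsmul_eq_mul] at hu hu'
  have hρirr : Irrational ρ := hρ.irrational
  -- the normal vector n = u × u' is non-zero
  have hu0 : u ≠ 0 := by
    intro h; apply hv0; rw [← hu]; simp [h]
  have hn : cvec u u' ≠ 0 := by
    intro hc
    have h0 : (u 1 : ℂ) * u' 2 - u 2 * u' 1 = 0 := by exact_mod_cast congr_fun hc 0
    have h1 : (u 2 : ℂ) * u' 0 - u 0 * u' 2 = 0 := by exact_mod_cast congr_fun hc 1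
    have h2 : (u 0 : ℂ) * u' 1 - u 1 * u' 0 = 0 := by exact_mod_cast congr_fun hc 2
    obtain ⟨k, hk⟩ := Function.ne_iff.mp hu0
    have hu3 := hu
    have hu3' := hu'
    rw [Fin.sum_univ_three] at hu3 hu3'
    have hpar : ∀ k : Fin 3, (u k : ℂ) * ((ρ : ℂ) * v) = (u' k : ℂ) * v := by
      intro k
      rw [← hu3', ← hu3]
      match k with
      | 0 => linear_combination (z 1) * h2 - (z 2) * h1
      | 1 => linear_combination (-(z 0)) * h2 + (z 2) * h0
      | 2 => linear_combination (z 0) * h1 - (z 1) * h0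
    have hkC : (u k : ℂ) ≠ 0 := by exact_mod_cast hk
    have hρC : (ρ : ℂ) = (u' k : ℂ) / (u k : ℂ) := by
      rw [eq_div_iff hkC]
      have := hpar k
      have h3 : ((u k : ℂ) * (ρ : ℂ) - (u' k : ℂ)) * v = 0 := by linear_combination this
      rcases mul_eq_zero.mp h3 with h4 | h4
      · linear_combination h4
      · exact absurd h4 hv0
    apply hρirr
    refine ⟨(u' k : ℚ) / (u k : ℚ), ?_⟩
    have : ((((u' k : ℚ) / (u k : ℚ) : ℚ) : ℝ) : ℂ) = (ρ : ℂ) := by rw [hρC]; push_cast; rfl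
    exact_mod_cast this
  -- LEMMA P with exponent e = m₀ + 1 ≥ 1
  obtain ⟨m₀, hm₀⟩ := hP
  set e : ℕ := m₀ + 1 with he
  -- constants
  have hvpos : 0 < ‖v‖ := norm_pos_iff.mpr hv0
  set Nu : ℝ := ∑ i, |(u i : ℝ)| with hNu
  set Nu' : ℝ := ∑ i, |(u' i : ℝ)| with hNu'
  have hNu0 : 0 ≤ Nu := Finset.sum_nonneg fun _ _ => abs_nonneg _
  have hNu'0 : 0 ≤ Nu' := Finset.sum_nonneg fun _ _ => abs_nonneg _
  set c : ℝ := 1 + (|ρ| + 1) * Nu + Nu' with hc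
  have hc1 : 1 ≤ c := by
    have : 0 ≤ (|ρ| + 1) * Nu + Nu' := by positivity
    rw [hc]; linarith only [this]
  set B : ℕ := (cvec u u' 0).natAbs + (cvec u u' 1).natAbs + 2 with hB
  obtain ⟨L, hL⟩ := exists_nat_ge (‖v‖ + c ^ e + hexp B + 1)
  -- a good approximation p/q of ρ at level max (e+1) L
  obtain ⟨r, hden, hne, hlt⟩ := hρ (max (e + 1) L)
  have hq1 : 1 ≤ r.den := r.den_pos
  have hqR1 : (1 : ℝ) ≤ r.den := by exact_mod_cast hq1
  have hqR0 : (0 : ℝ) < r.den := by linarith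
  have hqe : e + 1 ≤ r.den := le_trans (le_max_left _ _) hden
  have hqL : (‖v‖ + c ^ e + hexp B + 1 : ℝ) ≤ r.den :=
    hL.trans (by exact_mod_cast le_trans (le_max_right _ _) hden)
  -- the form p u − q u'
  set w : Fin 3 → ℤ := fun i => r.num * u i - r.den * u' i with hw
  have hnum : ((r.num : ℤ) : ℂ) = (r : ℂ) * (r.den : ℂ) := by
    have h1 : ((r * r.den : ℚ) : ℂ) = ((r.num : ℚ) : ℂ) := by rw [Rat.mul_den_eq_num]
    push_cast at h1
    rw [← h1]
  have hform : ∑ i, (w i : ℂ) * z i =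
      (r.den : ℂ) * ((((r : ℝ) - ρ : ℝ)) : ℂ) * v := by
    have e1 : ∑ i, (w i : ℂ) * z i =
        (r.num : ℂ) * ∑ i, (u i : ℂ) * z i -
          (r.den : ℂ) * ∑ i, (u' i : ℂ) * z i := by
      rw [Finset.mul_sum, Finset.mul_sum, ← Finset.sum_sub_distrib]
      refine Finset.sum_congr rfl fun i _ => ?_
      simp only [hw]; push_cast; ring
    rw [e1, hu, hu', hnum]; push_cast; ring
  have hnorm : ‖∑ i, (w i : ℂ) * z i‖ = (r.den : ℝ) * |ρ - r| * ‖v‖ := by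
    rw [hform, norm_mul, norm_mul, Complex.norm_natCast, Complex.norm_real, Real.norm_eq_abs,
      abs_sub_comm]
  have hw0 : w ≠ 0 := by
    intro h0
    have : (r.den : ℝ) * |ρ - r| * ‖v‖ = 0 := by rw [← hnorm, h0]; simp
    rcases mul_eq_zero.mp this with h1 | h1
    · rcases mul_eq_zero.mp h1 with h2 | h2
      · exact hqR0.ne' h2
      · exact hne (sub_eq_zero.mp (abs_eq_zero.mp h2))
    · exact hvpos.ne' h1
  -- height of the form: 1 + |w|₁ ≤ c q
  have hp_le : |(r.num : ℝ)| ≤ (|ρ| + 1) * r.den := by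
    have h1 : |ρ - r| < 1 := hlt.trans_le (by
      rw [Real.exp_le_one_iff]; exact neg_nonpos.mpr (by positivity))
    have h2 : |(r : ℝ)| ≤ |ρ| + 1 := by
      have := abs_sub_abs_le_abs_sub (r : ℝ) ρ; rw [abs_sub_comm] at this; linarith
    have h3 : (r : ℝ) * r.den = r.num := by exact_mod_cast Rat.mul_den_eq_num r
    rw [← h3, abs_mul, Nat.abs_cast]
    exact mul_le_mul_of_nonneg_right h2 hqR0.le
  have hW : 1 + ∑ i, |(w i : ℝ)| ≤ c * r.den := by
    have h1 : ∑ i, |(w i : ℝ)| ≤ |(r.num : ℝ)| * Nu + (r.den : ℝ) * Nu' := by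
      rw [hNu, hNu', Finset.mul_sum, Finset.mul_sum, ← Finset.sum_add_distrib]
      refine Finset.sum_le_sum fun i _ => ?_
      simp only [hw]; push_cast
      calc |(r.num : ℝ) * u i - r.den * u' i| ≤ |(r.num : ℝ) * u i| + |(r.den : ℝ) * u' i| :=
            abs_sub _ _
        _ = |(r.num : ℝ)| * |(u i : ℝ)| + (r.den : ℝ) * |(u' i : ℝ)| := by
            rw [abs_mul, abs_mul, Nat.abs_cast]
    have h2 : |(r.num : ℝ)| * Nu ≤ (|ρ| + 1) * r.den * Nu := mul_le_mul_of_nonneg_right hp_le hNu0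
    calc 1 + ∑ i, |(w i : ℝ)| ≤ 1 + ((|ρ| + 1) * r.den * Nu + (r.den : ℝ) * Nu') := by
          linarith only [h1, h2]
      _ ≤ r.den + ((|ρ| + 1) * r.den * Nu + (r.den : ℝ) * Nu') := by linarith only [hqR1]
      _ = c * r.den := by rw [hc]; ring
  -- smallness: ‖form‖ < exp(−((c q)^e + a_B))
  have hsmall : ‖∑ i, (w i : ℂ) * z i‖ <
      Real.exp (-((c * r.den) ^ e + hexp B)) := by
    rw [hnorm]
    have h1 : (r.den : ℝ) * |ρ - r| * ‖v‖ <
        (r.den : ℝ) * ‖v‖ * Real.exp (-((r.den : ℝ) ^ max (e + 1) L)) := by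
      have := mul_lt_mul_of_pos_left hlt (mul_pos hqR0 hvpos)
      calc (r.den : ℝ) * |ρ - r| * ‖v‖ = (r.den : ℝ) * ‖v‖ * |ρ - r| := by ring
        _ < (r.den : ℝ) * ‖v‖ * Real.exp (-((r.den : ℝ) ^ max (e + 1) L)) := this
    refine h1.trans_le ?_
    have hqv : 0 < (r.den : ℝ) * ‖v‖ := mul_pos hqR0 hvpos
    rw [← Real.exp_log hqv, ← Real.exp_add]
    apply Real.exp_le_exp.mpr
    have hlog : Real.log ((r.den : ℝ) * ‖v‖) ≤ (r.den : ℝ) * ‖v‖ - 1 := Real.log_le_sub_one_of_pos hqv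
    have hpow1 : (r.den : ℝ) ^ (e + 1) ≤ (r.den : ℝ) ^ max (e + 1) L :=
      pow_le_pow_right₀ hqR1 (le_max_left _ _)
    have hqe1 : (r.den : ℝ) ≤ (r.den : ℝ) ^ e := by
      calc (r.den : ℝ) = (r.den : ℝ) ^ 1 := (pow_one _).symm
        _ ≤ (r.den : ℝ) ^ e := pow_le_pow_right₀ hqR1 (by omega)
    have hqe0 : (1 : ℝ) ≤ (r.den : ℝ) ^ e := one_le_pow₀ hqR1
    have h2 : (r.den : ℝ) ^ e * (‖v‖ + c ^ e + hexp B + 1) ≤ (r.den : ℝ) ^ (e + 1) := by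
      rw [pow_succ]; exact mul_le_mul_of_nonneg_left hqL (by positivity)
    have h3 : (r.den : ℝ) * ‖v‖ ≤ (r.den : ℝ) ^ e * ‖v‖ := mul_le_mul_of_nonneg_right hqe1 hvpos.le
    have h4 : (c * r.den) ^ e = c ^ e * (r.den : ℝ) ^ e := mul_pow _ _ _
    have h5 : (hexp B : ℝ) ≤ (r.den : ℝ) ^ e * hexp B :=
      le_mul_of_one_le_left (Nat.cast_nonneg _) hqe0
    have h6 : (r.den : ℝ) ^ e * (‖v‖ + c ^ e + hexp B + 1) =
        (r.den : ℝ) ^ e * ‖v‖ + c ^ e * (r.den : ℝ) ^ e + (r.den : ℝ) ^ e * hexp B + (r.den : ℝ) ^ e := by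
      ring
    linarith only [hlog, hpow1, h2, h3, h4, h5, h6, hqe0]
  -- apply LEMMA P
  have hWe : (1 + ∑ i, |(w i : ℝ)|) ^ m₀ ≤ (c * r.den) ^ e + hexp B := by
    have hW1 : 1 ≤ 1 + ∑ i, |(w i : ℝ)| := by
      have : 0 ≤ ∑ i, |(w i : ℝ)| := Finset.sum_nonneg fun _ _ => abs_nonneg _
      linarith only [this]
    calc (1 + ∑ i, |(w i : ℝ)|) ^ m₀ ≤ (1 + ∑ i, |(w i : ℝ)|) ^ e := pow_le_pow_right₀ hW1 (by omega)
      _ ≤ (c * r.den) ^ e := pow_le_pow_left₀ (by linarith only [hW1]) hW e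
      _ ≤ (c * r.den) ^ e + hexp B := by linarith only [Nat.cast_nonneg (α := ℝ) (hexp B)]
  obtain ⟨K, t, hKt⟩ := hm₀ w hw0 (hsmall.trans_le (Real.exp_le_exp.mpr (neg_le_neg hWe)))
  have ht : t ≠ 0 := by rintro rfl; exact hw0 (by rw [hKt]; simp)
  -- K ≥ B
  have hKB : B ≤ K := by
    by_contra hlt'
    have hle : hexp (K + 1) ≤ hexp B := hexp_strictMono.monotone (by omega)
    have h1 : 1 / (2 : ℝ) ^ hexp B ≤ ‖∑ i, (w i : ℂ) * z i‖ := by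
      calc 1 / (2 : ℝ) ^ hexp B ≤ 1 / (2 : ℝ) ^ hexp (K + 1) :=
            one_div_le_one_div_of_le (by positivity) (pow_le_pow_right₀ (by norm_num) hle)
        _ ≤ ‖∑ i, (hKvec K i : ℂ) * z i‖ := hlow K
        _ ≤ |(t : ℝ)| * ‖∑ i, (hKvec K i : ℂ) * z i‖ := by
            apply le_mul_of_one_le_left (norm_nonneg _)
            rw [← Int.cast_abs]; exact_mod_cast Int.one_le_abs ht
        _ = ‖∑ i, (w i : ℂ) * z i‖ := by
            rw [hKt, ← Complex.norm_intCast, ← norm_mul, Finset.mul_sum]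
            congr 1
            refine Finset.sum_congr rfl fun i _ => ?_
            simp only [Pi.smul_apply, smul_eq_mul, Int.cast_mul]; ring
    have h2 : ‖∑ i, (w i : ℂ) * z i‖ < 1 / (2 : ℝ) ^ hexp B := by
      calc ‖∑ i, (w i : ℂ) * z i‖ < Real.exp (-((c * r.den) ^ e + hexp B)) := hsmall
        _ ≤ Real.exp (-(hexp B : ℝ)) := Real.exp_le_exp.mpr (by
            linarith only [pow_nonneg (mul_nonneg (by linarith only [hc1]) hqR0.le : (0:ℝ) ≤ c * r.den) e])
        _ ≤ 1 / (2 : ℝ) ^ hexp B := by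
            rw [Real.exp_neg, ← one_div]
            exact one_div_le_one_div_of_le (by positivity) (two_pow_le_exp_nat _)
    linarith only [h1, h2]
  -- n · h_K = 0
  have hE : Edef (cvec u u') K = 0 := by
    have e1 : ∑ i, cvec u u' i * w i = 0 := by
      simp only [hw, Fin.sum_univ_three, cvec_zero, cvec_one, cvec_two]; ring
    rw [hKt] at e1
    have e2 : ∑ i, cvec u u' i * (t • hKvec K) i = t * Edef (cvec u u') K := by
      rw [Edef, Finset.mul_sum]
      refine Finset.sum_congr rfl fun i _ => ?_
      simp only [Pi.smul_apply, smul_eq_mul]; ring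
    rw [e2] at e1
    rcases mul_eq_zero.mp e1 with h1 | h1
    · exact absurd h1 ht
    · exact h1
  exact hn (eq_zero_of_Edef_eq_zero (by rw [hB] at hKB; exact hKB) hE)

/-- `ℓ₀ = arctan(4/3) ≥ 1/2` (`> arctan 1 = π/4`). -/
private theorem half_le_ell : 1 / 2 ≤ ell := by
  have h1 : Real.arctan 1 < ell := Real.arctan_strictMono (by norm_num : (1 : ℝ) < 4 / 3)
  rw [Real.arctan_one] at h1
  linarith [Real.pi_gt_three]

/-- `τ₀ < 1`. -/
private theorem tau_lt_one : tau < 1 := by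
  unfold tau
  rw [div_lt_one Real.pi_pos]
  linarith [ell_lt, Real.pi_pos]

/-- Lower bound for the staircase error: `err_K ≥ ℓ₀ · 2^{−a_{K+1}}` (the first tail term). -/
theorem err_lower (K : ℕ) :
    ell / (2 : ℝ) ^ hexp (K + 1) ≤ yB - ((aB K : ℝ) * Real.pi + (bB K : ℝ) * ell) := by
  rw [err_eq]
  have h1 : ytx tau (K + 1) ≤ ∑' k, ytx tau (k + (K + 1)) := by
    have := (summable_ytx_tail tau_pos.le tau_le (K + 1)).sum_le_tsum (Finset.range 1)
      (fun k _ => (ytx_pos tau_pos _).le)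
    simpa using this
  have h2 : tau / (2 : ℝ) ^ hexp (K + 1) ≤ ytx tau (K + 1) := by
    unfold ytx pwx
    split_ifs with hK
    · exact div_le_div_of_nonneg_right tau_lt_one.le (by positivity)
    · exact le_rfl
  calc ell / (2 : ℝ) ^ hexp (K + 1) = Real.pi * (tau / (2 : ℝ) ^ hexp (K + 1)) := by rw [ell_eq]; ring
    _ ≤ Real.pi * ytx tau (K + 1) := mul_le_mul_of_nonneg_left h2 Real.pi_pos.le
    _ ≤ Real.pi * ∑' k, ytx tau (k + (K + 1)) := mul_le_mul_of_nonneg_left h1 Real.pi_pos.le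

/-- The planted form `h_K · z_B = i · 2^{a_K} · err_K`. -/
theorem hKvec_form_zB (K : ℕ) :
    ∑ i, (hKvec K i : ℂ) * zB i =
      ((((2 : ℝ) ^ hexp K * (yB - ((aB K : ℝ) * Real.pi + (bB K : ℝ) * ell)) : ℝ)) : ℂ) * I := by
  rw [form_zB, hKvec_zero, hKvec_one, hKvec_two]
  congr 1
  unfold aB bB
  push_cast
  have h2 : (0 : ℝ) < (2 : ℝ) ^ hexp K := by positivity
  field_simp
  ring

/-- Lower bound `2^{−a_{K+1}} ≤ ‖h_K · z_B‖` for the planted forms of `z_B`. -/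
theorem hKvec_form_lower_zB (K : ℕ) :
    1 / (2 : ℝ) ^ hexp (K + 1) ≤ ‖∑ i, (hKvec K i : ℂ) * zB i‖ := by
  rw [hKvec_form_zB, norm_mul, Complex.norm_I, mul_one, Complex.norm_real, Real.norm_eq_abs,
    abs_of_pos (mul_pos (by positivity) (err_pos K))]
  have h2 : (2 : ℝ) ≤ 2 ^ hexp K :=
    calc (2 : ℝ) = 2 ^ 1 := by norm_num
      _ ≤ 2 ^ hexp K := pow_le_pow_right₀ (by norm_num) (one_le_hexp K)
  have hpos : (0 : ℝ) < 2 ^ hexp (K + 1) := by positivity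
  calc 1 / (2 : ℝ) ^ hexp (K + 1) ≤ 2 * (ell / 2 ^ hexp (K + 1)) := by
        rw [mul_div_assoc', div_le_div_iff_of_pos_right hpos]; linarith [half_le_ell]
    _ ≤ 2 ^ hexp K * (ell / 2 ^ hexp (K + 1)) :=
        mul_le_mul_of_nonneg_right h2 (div_nonneg ell_pos.le hpos.le)
    _ ≤ 2 ^ hexp K * (yB - ((aB K : ℝ) * Real.pi + (bB K : ℝ) * ell)) :=
        mul_le_mul_of_nonneg_left (err_lower K) (by positivity)

/-- **`z_B` has NO hyper-Liouville pair in its span, mod `PiEllMeasure`.** -/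
theorem not_hasHLPairInSpan_zB_of (hM : PiEllMeasure) : ¬ HasHLPairInSpan zB :=
  not_hasHLPairInSpan_of_planted hKvec_form_lower_zB (smallFormsArePlanted_zB_of hM)

/-- **`z_B` has NO hyper-Liouville pair in its span, mod the tree's record of Baker 1975 Thm 3.1**
(`Literature.NumberTheory.Transcendental.baker1975_thm_3_1`, DISCHARGED in the tree by
`Literature.NumberTheory.Transcendental.baker1975_thm_3_1_holds`). -/
theorem not_hasHLPairInSpan_zB_of_baker (hB : Baker1975Thm31) : ¬ HasHLPairInSpan zB :=
  not_hasHLPairInSpan_zB_of (piEllMeasure_of_baker hB)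

end MemberPkg

end Bilog
end LatCell
end HyperCell
end Summit.Schanuel.Schanuel.Theorems.RootDecomp1KHyper
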